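import Summits.NavierStokesRegularity.NavierStokesRegularity.Theorems.FlatGaugeAtSingularity.Negative.FlatGaugeAtSingularityFalseOfDenseVortexLines

/-!
# `FlatGaugeAtSingularity` (stmt-NavierStokesRegularity-1252): a FAT vortex line kills every chart

Negative-side support for the crux `FlatGaugeAtSingularity` (FG) of route `FlatSwirlGauge`, by the lead of its
registered line (cut FG ⟺ K ∧ D; K = `stub_vortexChartAtSingularity` = "a bounded `C²` first integral `α` of
the vorticity, nondegenerate off an axis-like thin set, on a fixed backward cylinder at the singular point").
The companion file `FlatGaugeAtSingularityFalseOfDenseVortexLines` kills K with ONE vortex line dense in an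
OPEN sub-ball (topological transitivity — provable for almost no explicit field). This file replaces "dense in an
open set" by the measure-theoretic currency in which Lagrangian chaos of a frozen 3-D field is actually
expected (DombreEtAl1986, ArnoldKhesin1998 Ch. II: chaotic SEAS of positive volume between KAM tori):

* `measure_levelSet_inter_fderiv_ne_zero_eq_zero` — pure measure theory on a finite-dimensional real normed
  space with an additive Haar measure: a level set `{a = c}` of a `C¹` function on an open set is NULL off the
  critical set `{Da = 0}`. Proof: at a point `x` of the level set with `L = Da(x) ≠ 0` pick `v` with `L v = 1`;
  the `C¹` map `F y = y + (a y − c − L(y − x)) • v` has `DF(x) = id` and sends the level set into the affine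
  hyperplane `x + ker L` (null, `Measure.addHaar_affineSubspace`); its `C¹` local inverse `G` (inverse function
  theorem, `ContDiffAt.to_localInverse`) maps null sets to null sets
  (`addHaar_image_eq_zero_of_differentiableOn_of_addHaar_eq_zero`), and near `x` the level set lies in
  `G '' (x + ker L)`; `measure_null_of_locally_null` globalises.
* `volume_gradient_eq_zero_inter_curl_ne_zero_of_chart` — a kinematic vortex chart
  (`Literature.Analysis.FluidPDE.IsVortexChartOn`) forces, in every time slice, `∇α ≠ 0` a.e. on
  `{curl u ≠ 0} ∩ B_ρ(x₀)`: the set `{∇α = 0, curl u ≠ 0}` lies in `{C₀‖∇α‖ < δ‖curl u‖}` for every `δ > 0`,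
  whose volume in the ball is `≤ C₀ δ² ρ → 0` (`IsVortexChartOn.volume_ratio_lt_le`). This is the exact
  integrability content of K: `α(t, ·)` is an a.e.-NONDEGENERATE first integral of the frozen vorticity field
  on the support of the vorticity.
* `firstIntegral_eq_on_closure_orbit` — a first integral is constant on (the trace in `U` of) the closure of
  any orbit it meets (chain rule + continuity; generalises `firstIntegral_eq_on_of_dense_orbit`).
* `not_isVortexChartOn_of_fat_vortexLine` — MAIN: if one time slice `t ∈ (T − ρ², T)` carries a vortex line
  `γ` (`γ' = curl (u t) ∘ γ`) staying in `B_ρ(x₀)` whose orbit closure meets `{curl (u t) ≠ 0} ∩ B_ρ(x₀)` in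
  POSITIVE VOLUME (a "fat" vortex line), then no kinematic vortex chart lives on `Q_ρ(T, x₀)`: `α(t, ·)` is
  constant on the orbit closure, so that positive-volume set splits into a part where `∇α = 0` (null by the
  chart) and a part of one level set where `∇α ≠ 0` (null by the level-set lemma).
* `fat_of_dense_vortexLine` — the dense-orbit hypothesis of the companion file is a special case.
* `not_isFlatSwirlGaugeOn_of_fat_vortexLine`, `not_hasFlatSwirlGauge_of_fat_vortexLines`,
  `flatGaugeAtSingularity_false_of_fatVortexLines` — the gauge / crux consequences: FG is FALSE modulo
  `FatVortexLinesAtSingularity` (inline: a Leray–Hopf classical blow-up at `(T, x₀)` with a fat frozen-time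
  vortex line inside every backward cylinder at `(T, x₀)`). Not constructible today (it contains a blow-up), so
  this is a NEGATIVE-MODULO lemma: any proof of K (hence of FG) must show that at a singularity, below some
  scale, NO frozen-time vortex line has an orbit closure of positive volume on the support of the vorticity —
  measure-theoretic integrability of the vortex-line flow at every time slice near the singular point.

Only Mathlib (inverse function theorem, Haar-measure null-set calculus), the landed definition files
`Literature/Analysis/FluidPDE/FlatSwirlGauge{,Chart}.lean` and the companion Negative file are used.
-/

-- the problem namespace `Summit.NavierStokesRegularity.NavierStokesRegularity` repeats the summit name by design (D-0017)
set_option linter.dupNamespace false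

noncomputable section

open Set MeasureTheory Metric Function Filter
open scoped RealInnerProductSpace ENNReal Topology
open Literature.Analysis.FluidPDE
open Summit.NavierStokesRegularity.NavierStokesRegularity.Theses.FlatSwirlGauge

namespace Summit.NavierStokesRegularity.NavierStokesRegularity.Theorems.FlatGaugeAtSingularity.Negative

/-! ### Pure measure theory: level sets of `C¹` functions are null off the critical set -/

section LevelSet

variable {E : Type*} [NormedAddCommGroup E] [NormedSpace ℝ E] [FiniteDimensional ℝ E]
  [MeasurableSpace E] [BorelSpace E]

/-- **Level sets of a `C¹` function are null off the critical set.** If `a` is `C¹` on an open set `U` of a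
finite-dimensional real normed space with an additive Haar measure `μ`, then for every value `c` the set
`{x ∈ U | a x = c, Da(x) ≠ 0}` is `μ`-null. (At such a point `x`, with `L = Da(x)` and `L v = 1`, the `C¹` map
`F y = y + (a y − c − L(y − x)) • v` has derivative `id` at `x` and maps the level set into the null hyperplane
`x + ker L`; locally the level set is the image of that hyperplane under the `C¹` local inverse of `F`, hence
null; `measure_null_of_locally_null` globalises.) [folklore] -/
theorem measure_levelSet_inter_fderiv_ne_zero_eq_zero (μ : Measure E) [μ.IsAddHaarMeasure]
    {U : Set E} (hU : IsOpen U) {a : E → ℝ} (ha : ContDiffOn ℝ 1 a U) (c : ℝ) :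
    μ {x | x ∈ U ∧ a x = c ∧ fderiv ℝ a x ≠ 0} = 0 := by
  haveI : CompleteSpace E := FiniteDimensional.complete ℝ E
  refine measure_null_of_locally_null _ fun x hx => ?_
  obtain ⟨hxU, hax, hL⟩ := hx
  set L : E →L[ℝ] ℝ := fderiv ℝ a x with hLdef
  -- a vector `v` with `L v = 1`
  obtain ⟨w, hw⟩ : ∃ w, L w ≠ 0 := by
    by_contra h
    push Not at h
    exact hL (ContinuousLinearMap.ext fun w => by simpa using h w)
  set v : E := (L w)⁻¹ • w with hvdef
  have hLv : L v = 1 := by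
    rw [hvdef, map_smul, smul_eq_mul, inv_mul_cancel₀ hw]
  -- the straightening map `F`
  set F : E → E := fun y => y + (a y - c - L (y - x)) • v with hFdef
  have haC : ContDiffAt ℝ 1 a x := ha.contDiffAt (hU.mem_nhds hxU)
  have hFC : ContDiffAt ℝ 1 F x := by
    have h1 : ContDiffAt ℝ 1 (fun y => a y - c - L (y - x)) x :=
      (haC.sub contDiffAt_const).sub
        (L.contDiff.contDiffAt.comp x (contDiffAt_id.sub contDiffAt_const))
    exact contDiffAt_id.add (h1.smul contDiffAt_const)
  have hFx : F x = x := by simp [hFdef, hax]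
  have hF' : HasFDerivAt F ((ContinuousLinearEquiv.refl ℝ E : E ≃L[ℝ] E) : E →L[ℝ] E) x := by
    have hda : HasFDerivAt a L x := (haC.differentiableAt (by simp)).hasFDerivAt
    have h1 : HasFDerivAt (fun y => a y - c - (L y - L x)) (L - L) x :=
      (hda.sub_const c).sub (L.hasFDerivAt.sub_const (L x))
    rw [sub_self] at h1
    have h5 := (hasFDerivAt_id x).add (h1.smul_const v)
    have h6 : HasFDerivAt F (ContinuousLinearMap.id ℝ E) x := by
      convert h5 using 1
      · ext y
        simp only [hFdef, map_sub, Pi.add_apply, id_eq]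
      · ext y
        simp
    rw [ContinuousLinearEquiv.coe_refl]
    exact h6
  -- the `C¹` local inverse `G` of `F` near `F x = x`
  set G : E → E := hFC.localInverse hF' one_ne_zero with hGdef
  have hGC : ContDiffAt ℝ 1 G x := by
    have := hFC.to_localInverse hF' one_ne_zero
    rwa [hFx] at this
  have hGev : ∀ᶠ z in 𝓝 x, ContDiffAt ℝ 1 G z := hGC.eventually (by simp)
  obtain ⟨W', hW'G, hW'open, hxW'⟩ := _root_.eventually_nhds_iff.1 hGev
  have hGdiff : DifferentiableOn ℝ G W' := fun z hz =>
    ((hW'G z hz).differentiableAt (by simp)).differentiableWithinAt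
  have hlinv : ∀ᶠ y in 𝓝 x, G (F y) = y :=
    (hFC.hasStrictFDerivAt' hF' one_ne_zero).eventually_left_inverse
  -- the hyperplane `H = x + ker L` is null
  set H : Set E := {z | L (z - x) = 0} with hHdef
  have hHnull : μ H = 0 := by
    set P : AffineSubspace ℝ E := AffineSubspace.mk' x (LinearMap.ker (L : E →ₗ[ℝ] ℝ)) with hPdef
    have hPH : (P : Set E) = H := by
      ext z
      simp [hPdef, hHdef, AffineSubspace.mem_mk', vsub_eq_sub]
    have hPtop : P ≠ ⊤ := by
      intro htop
      have hmem : x + v ∈ P := by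
        rw [htop]
        exact AffineSubspace.mem_top ℝ E _
      have h0 : L v = 0 := by
        have h1 : (x + v : E) ∈ (P : Set E) := hmem
        rw [hPH] at h1
        simpa [hHdef] using h1
      rw [hLv] at h0
      exact one_ne_zero h0
    rw [← hPH]
    exact Measure.addHaar_affineSubspace μ P hPtop
  -- `F` maps the level set `{a = c}` into `H`
  have hFH : ∀ y, a y = c → F y ∈ H := by
    intro y hy
    have h1 : F y - x = (y - x) + (a y - c - L (y - x)) • v := by
      simp only [hFdef]
      abel
    simp only [hHdef, mem_setOf_eq]
    rw [h1, map_add, map_smul, hLv, hy]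
    simp
  -- the neighbourhood `{G ∘ F = id} ∩ F⁻¹' W'` of `x`, in which the level set lies in `G '' (H ∩ W')`
  have hVmem : {y | G (F y) = y ∧ F y ∈ W'} ∈ 𝓝 x := by
    have h2 : ∀ᶠ y in 𝓝 x, F y ∈ W' :=
      hFC.continuousAt.preimage_mem_nhds (by rw [hFx]; exact hW'open.mem_nhds hxW')
    exact hlinv.and h2
  refine ⟨{y | y ∈ U ∧ a y = c ∧ fderiv ℝ a y ≠ 0} ∩ {y | G (F y) = y ∧ F y ∈ W'},
    inter_mem_nhdsWithin _ hVmem, ?_⟩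
  refine measure_mono_null (t := G '' (H ∩ W')) ?_ ?_
  · rintro y ⟨⟨-, hy, -⟩, hGF, hFW⟩
    exact ⟨F y, ⟨hFH y hy, hFW⟩, hGF⟩
  · exact addHaar_image_eq_zero_of_differentiableOn_of_addHaar_eq_zero μ
      (hGdiff.mono inter_subset_right) (measure_mono_null inter_subset_left hHnull)

end LevelSet

/-! ### Pure kinematics: a first integral is constant on the closure of any orbit -/

section Kinematics

variable {E : Type*} [NormedAddCommGroup E] [InnerProductSpace ℝ E] [CompleteSpace E]
  {V : E → E} {a : E → ℝ} {U : Set E} {γ : ℝ → E}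

/-- **A first integral is constant on the closure of an orbit.** If `a` is differentiable on an open set
`U`, `⟪V, ∇a⟫ = 0` on `U`, and `γ` is an integral curve of `V` staying in `U`, then `a = a (γ 0)` at every point
of `U` in the closure of the orbit `range γ` (`firstIntegral_comp_eq` + continuity of `a` on `U`). [folklore] -/
theorem firstIntegral_eq_on_closure_orbit (hU : IsOpen U) (ha : DifferentiableOn ℝ a U)
    (hVa : ∀ x ∈ U, ⟪V x, gradient a x⟫ = 0) (hγ : ∀ s, HasDerivAt γ (V (γ s)) s)
    (hγU : ∀ s, γ s ∈ U) {x : E} (hx : x ∈ U) (hxc : x ∈ closure (range γ)) :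
    a x = a (γ 0) := by
  obtain ⟨v, hv, hvx⟩ := mem_closure_iff_seq_limit.1 hxc
  have hconst : ∀ n, a (v n) = a (γ 0) := by
    intro n
    obtain ⟨s, hs⟩ := hv n
    rw [← hs]
    exact firstIntegral_comp_eq hU ha hVa hγ hγU s 0
  have hcont : ContinuousAt a x :=
    (ha.continuousOn.continuousWithinAt hx).continuousAt (hU.mem_nhds hx)
  have h1 : Tendsto (fun n => a (v n)) atTop (𝓝 (a x)) := hcont.tendsto.comp hvx
  have h2 : Tendsto (fun n => a (v n)) atTop (𝓝 (a (γ 0))) := by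
    simp only [hconst]
    exact tendsto_const_nhds
  exact tendsto_nhds_unique h1 h2

end Kinematics

/-! ### Charts: a.e. nondegeneracy on the support of the vorticity; fat vortex lines -/

section Chart

variable {ν T ρ C₀ M : ℝ} {u : ℝ → EuclideanSpace ℝ (Fin 3) → EuclideanSpace ℝ (Fin 3)}
  {x₀ : EuclideanSpace ℝ (Fin 3)} {α : ℝ → EuclideanSpace ℝ (Fin 3) → ℝ}
  {b : ℝ → EuclideanSpace ℝ (Fin 3) → EuclideanSpace ℝ (Fin 3)} {d : ℝ → EuclideanSpace ℝ (Fin 3) → ℝ}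

/-- The momentum of a kinematic vortex chart is `C²` on the ball in each time slice (slice of the `C²`
clause). [folklore] -/
theorem contDiffOn_slice (h : IsVortexChartOn u T x₀ ρ C₀ M α d) {t : ℝ}
    (ht : t ∈ Ioo (T - ρ ^ 2) T) : ContDiffOn ℝ 2 (α t) (ball x₀ ρ) := by
  have hcomp :
      ContDiffOn ℝ 2 (uncurry α ∘ fun x : EuclideanSpace ℝ (Fin 3) => (t, x)) (ball x₀ ρ) :=
    h.2.2.1.comp (contDiffOn_const.prodMk contDiffOn_id) fun x hx => mk_mem_prod ht hx
  simpa [Function.comp_def] using hcomp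

/-- **A chart is a.e. nondegenerate on the support of the vorticity.** If `(α, d, C₀, M)` is a kinematic
vortex chart for `u` on `Q_ρ(T, x₀)`, then in every time slice `t ∈ (T − ρ², T)` the set of points of
`B_ρ(x₀)` where `∇α(t, ·) = 0` but `curl (u t) ≠ 0` is Lebesgue-null: it lies in `{C₀‖∇α‖ < δ‖curl u‖} ∩ B_ρ`
for every `δ ∈ (0, ρ)`, a set of volume `≤ C₀ δ² ρ` (`IsVortexChartOn.volume_ratio_lt_le`), and `δ → 0⁺`.
This is the exact integrability content of stub K: `α(t, ·)` is an a.e.-nondegenerate first integral of the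
frozen vorticity field wherever the vorticity does not vanish. [folklore] -/
theorem volume_gradient_eq_zero_inter_curl_ne_zero_of_chart (h : IsVortexChartOn u T x₀ ρ C₀ M α d)
    {t : ℝ} (ht : t ∈ Ioo (T - ρ ^ 2) T) :
    volume ({x | gradient (α t) x = 0 ∧ curl (u t) x ≠ 0} ∩ ball x₀ ρ) = 0 := by
  have hρ : 0 < ρ := h.1
  have hle : ∀ δ ∈ Ioo 0 ρ,
      volume ({x | gradient (α t) x = 0 ∧ curl (u t) x ≠ 0} ∩ ball x₀ ρ) ≤
        ENNReal.ofReal (C₀ * δ ^ 2 * ρ) := by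
    intro δ hδ
    refine (measure_mono ?_).trans (h.volume_ratio_lt_le ht hδ)
    rintro x ⟨⟨hg, hω⟩, hxB⟩
    refine ⟨?_, hxB⟩
    rw [mem_setOf_eq, hg, norm_zero, mul_zero]
    exact mul_pos hδ.1 (norm_pos_iff.2 hω)
  have htend : Tendsto (fun δ : ℝ => ENNReal.ofReal (C₀ * δ ^ 2 * ρ)) (𝓝[>] 0) (𝓝 0) := by
    have hc : Continuous fun δ : ℝ => ENNReal.ofReal (C₀ * δ ^ 2 * ρ) :=
      ENNReal.continuous_ofReal.comp (by fun_prop)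
    have := (hc.tendsto 0).mono_left (nhdsWithin_le_nhds (s := Ioi (0 : ℝ)))
    simpa using this
  have hev : ∀ᶠ δ in 𝓝[>] (0 : ℝ),
      volume ({x | gradient (α t) x = 0 ∧ curl (u t) x ≠ 0} ∩ ball x₀ ρ) ≤
        ENNReal.ofReal (C₀ * δ ^ 2 * ρ) := by
    filter_upwards [Ioo_mem_nhdsGT hρ] with δ hδ using hle δ hδ
  exact nonpos_iff_eq_zero.1 (ge_of_tendsto htend hev)

/-- **A fat vortex line in one time slice kills every kinematic vortex chart on the cylinder** (stub K of the
registered line). Let `(α, d, C₀, M)` be a kinematic vortex chart for `u` on `Q_ρ(T, x₀)`, `t ∈ (T − ρ², T)`,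
and `γ` an integral curve of `curl (u t)` staying in `B_ρ(x₀)` whose orbit closure meets
`{curl (u t) ≠ 0} ∩ B_ρ(x₀)` in positive volume. Contradiction: `α(t, ·)` is constant (`= α(t, γ 0)`) on the
orbit closure inside the ball (`firstIntegral_eq_on_closure_orbit`), so that positive-volume set is covered by
`{∇α = 0, curl u ≠ 0} ∩ B_ρ` (null, `volume_gradient_eq_zero_inter_curl_ne_zero_of_chart`) and by the part
of ONE level set of `α(t, ·)` where `∇α ≠ 0` (null, `measure_levelSet_inter_fderiv_ne_zero_eq_zero`).
[folklore] -/
theorem not_isVortexChartOn_of_fat_vortexLine {t : ℝ} (ht : t ∈ Ioo (T - ρ ^ 2) T)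
    {γ : ℝ → EuclideanSpace ℝ (Fin 3)} (hγ : ∀ s, HasDerivAt γ (curl (u t) (γ s)) s) (hγB : ∀ s, γ s ∈ ball x₀ ρ)
    (hfat : volume (closure (range γ) ∩ ball x₀ ρ ∩ {x | curl (u t) x ≠ 0}) ≠ 0) :
    ¬ IsVortexChartOn u T x₀ ρ C₀ M α d := by
  intro h
  apply hfat
  have hC : ContDiffOn ℝ 2 (α t) (ball x₀ ρ) := contDiffOn_slice h ht
  have hdiff : DifferentiableOn ℝ (α t) (ball x₀ ρ) := hC.differentiableOn (by simp)
  have hVa : ∀ x ∈ ball x₀ ρ, ⟪curl (u t) x, gradient (α t) x⟫ = 0 :=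
    fun x hx => (h.2.2.2.2 t ht x hx).2.1
  have hconst : ∀ x ∈ ball x₀ ρ, x ∈ closure (range γ) → α t x = α t (γ 0) :=
    fun x hx hxc => firstIntegral_eq_on_closure_orbit isOpen_ball hdiff hVa hγ hγB hx hxc
  have hsub : closure (range γ) ∩ ball x₀ ρ ∩ {x | curl (u t) x ≠ 0} ⊆
      ({x | gradient (α t) x = 0 ∧ curl (u t) x ≠ 0} ∩ ball x₀ ρ) ∪
        {x | x ∈ ball x₀ ρ ∧ α t x = α t (γ 0) ∧ fderiv ℝ (α t) x ≠ 0} := by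
    rintro x ⟨⟨hxc, hxB⟩, hω⟩
    by_cases hg : gradient (α t) x = 0
    · exact Or.inl ⟨⟨hg, hω⟩, hxB⟩
    · refine Or.inr ⟨hxB, hconst x hxB hxc, fun hf => hg ?_⟩
      simp [gradient, hf]
  refine measure_mono_null hsub (measure_union_null
    (volume_gradient_eq_zero_inter_curl_ne_zero_of_chart h ht) ?_)
  exact measure_levelSet_inter_fderiv_ne_zero_eq_zero volume isOpen_ball (hC.of_le (by simp)) _

/-- The dense-orbit hypothesis of `not_isVortexChartOn_of_dense_vortexLine` is a special case of fatness: if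
the orbit of `γ` is dense in an open `U ⊆ B_ρ(x₀)` containing an open nonempty `W` on which `curl (u t) ≠ 0`,
then the orbit closure meets `{curl (u t) ≠ 0} ∩ B_ρ(x₀)` in positive volume (it contains `W`). [folklore] -/
theorem fat_of_dense_vortexLine {t : ℝ} {U : Set (EuclideanSpace ℝ (Fin 3))} (hUB : U ⊆ ball x₀ ρ)
    {γ : ℝ → EuclideanSpace ℝ (Fin 3)} (hdense : U ⊆ closure (range γ))
    {W : Set (EuclideanSpace ℝ (Fin 3))} (hW : IsOpen W) (hWne : W.Nonempty) (hWU : W ⊆ U)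
    (hcurl : ∀ x ∈ W, curl (u t) x ≠ 0) :
    volume (closure (range γ) ∩ ball x₀ ρ ∩ {x | curl (u t) x ≠ 0}) ≠ 0 := by
  have hWsub : W ⊆ closure (range γ) ∩ ball x₀ ρ ∩ {x | curl (u t) x ≠ 0} :=
    fun x hx => ⟨⟨hdense (hWU hx), hUB (hWU hx)⟩, hcurl x hx⟩
  exact fun h0 => (hW.measure_pos volume hWne).ne' (measure_mono_null hWsub h0)

/-- The companion file's obstruction `not_isVortexChartOn_of_dense_vortexLine` re-derived from the fat one
(`fat_of_dense_vortexLine` + `not_isVortexChartOn_of_fat_vortexLine`): the measure-theoretic hypothesis is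
the weaker one. [folklore] -/
theorem not_isVortexChartOn_of_dense_vortexLine' {t : ℝ} (ht : t ∈ Ioo (T - ρ ^ 2) T)
    {U : Set (EuclideanSpace ℝ (Fin 3))} (hUB : U ⊆ ball x₀ ρ) {γ : ℝ → EuclideanSpace ℝ (Fin 3)}
    (hγ : ∀ s, HasDerivAt γ (curl (u t) (γ s)) s) (hγU : ∀ s, γ s ∈ U)
    (hdense : U ⊆ closure (range γ)) {W : Set (EuclideanSpace ℝ (Fin 3))} (hW : IsOpen W)
    (hWne : W.Nonempty) (hWU : W ⊆ U) (hcurl : ∀ x ∈ W, curl (u t) x ≠ 0) :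
    ¬ IsVortexChartOn u T x₀ ρ C₀ M α d :=
  not_isVortexChartOn_of_fat_vortexLine ht hγ (fun s => hUB (hγU s))
    (fat_of_dense_vortexLine hUB hdense hW hWne hWU hcurl)

/-- **A fat vortex line in one time slice kills every flat swirl gauge on the cylinder**: a gauge is in
particular a kinematic vortex chart (`isVortexChartOn_of_gauge`). [folklore] -/
theorem not_isFlatSwirlGaugeOn_of_fat_vortexLine {t : ℝ} (ht : t ∈ Ioo (T - ρ ^ 2) T)
    {γ : ℝ → EuclideanSpace ℝ (Fin 3)} (hγ : ∀ s, HasDerivAt γ (curl (u t) (γ s)) s) (hγB : ∀ s, γ s ∈ ball x₀ ρ)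
    (hfat : volume (closure (range γ) ∩ ball x₀ ρ ∩ {x | curl (u t) x ≠ 0}) ≠ 0) :
    ¬ IsFlatSwirlGaugeOn ν u T x₀ ρ C₀ M α b d :=
  fun h => not_isVortexChartOn_of_fat_vortexLine ht hγ hγB hfat (isVortexChartOn_of_gauge h)

/-- **Fat vortex lines inside every backward cylinder at `(T, x₀)` exclude a flat swirl gauge there.** If for
every radius `ρ` with `0 < ρ`, `ρ² < T` some time slice `t ∈ (T − ρ², T)` of `Q_ρ(T, x₀)` carries a vortex line
staying in `B_ρ(x₀)` whose orbit closure meets `{curl (u t) ≠ 0} ∩ B_ρ(x₀)` in positive volume, then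
`¬ HasFlatSwirlGauge ν u T x₀`. [folklore] -/
theorem not_hasFlatSwirlGauge_of_fat_vortexLines
    (hfvl : ∀ ρ : ℝ, 0 < ρ → ρ ^ 2 < T → ∃ t ∈ Ioo (T - ρ ^ 2) T,
      ∃ γ : ℝ → EuclideanSpace ℝ (Fin 3), (∀ s, HasDerivAt γ (curl (u t) (γ s)) s) ∧ (∀ s, γ s ∈ ball x₀ ρ) ∧
      volume (closure (range γ) ∩ ball x₀ ρ ∩ {x | curl (u t) x ≠ 0}) ≠ 0) :
    ¬ HasFlatSwirlGauge ν u T x₀ := by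
  rintro ⟨ρ, C₀, M, α, b, d, hg⟩
  obtain ⟨t, ht, γ, hγ, hγB, hfat⟩ := hfvl ρ hg.radius_pos hg.sq_radius_lt
  exact not_isFlatSwirlGaugeOn_of_fat_vortexLine ht hγ hγB hfat hg

end Chart

/-! ### The crux is false modulo a blow-up with fat vortex lines -/

/-- **`FlatGaugeAtSingularity` is false modulo `FatVortexLinesAtSingularity`.** The hypothesis (inline; NOT
constructible today — it contains a finite-time blow-up of a Leray–Hopf classical solution): some `ν > 0`,
`T > 0`, a classical Navier–Stokes solution `(u, p)` on `ℝ³ × [0, T)` which is Leray–Hopf from a rapidly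
decaying datum, a point `x₀` at which `u` is unbounded on every backward cylinder (a singular point), and,
inside every backward cylinder `Q_ρ(T, x₀)`, a time slice carrying a vortex line that stays in `B_ρ(x₀)` and
whose orbit closure has positive volume on the support of the vorticity (a positive-volume "chaotic sea" of
the frozen vortex-line flow reaching down to the singular point — the measure-theoretic form of the crux's
`why it might fail`, DombreEtAl1986 / ArnoldKhesin1998 Ch. II). Conclusion: `¬ FlatGaugeAtSingularity`. So any
proof of the crux — indeed of its kinematic stub K alone — must prove that NO Navier–Stokes singularity has a
fat frozen-time vortex line at small scales. [folklore] -/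
theorem flatGaugeAtSingularity_false_of_fatVortexLines
    (H : ∃ (ν T : ℝ) (u : ℝ → EuclideanSpace ℝ (Fin 3) → EuclideanSpace ℝ (Fin 3))
      (p : ℝ → EuclideanSpace ℝ (Fin 3) → ℝ) (x₀ : EuclideanSpace ℝ (Fin 3)), 0 < ν ∧ 0 < T ∧
      IsClassicalNSSolutionOn (Set.Ico 0 T) ν 0 u p ∧ IsLerayHopfOn T ν 0 (u 0) u ∧
      HasRapidSpatialDecay (u 0) ∧
      ¬ (∃ r : ℝ, 0 < r ∧ ∃ K : ℝ, ∀ t ∈ Set.Ioo (T - r ^ 2) T, 0 ≤ t →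
          ∀ x ∈ Metric.ball x₀ r, ‖u t x‖ ≤ K) ∧
      ∀ ρ : ℝ, 0 < ρ → ρ ^ 2 < T → ∃ t ∈ Ioo (T - ρ ^ 2) T,
        ∃ γ : ℝ → EuclideanSpace ℝ (Fin 3), (∀ s, HasDerivAt γ (curl (u t) (γ s)) s) ∧
        (∀ s, γ s ∈ ball x₀ ρ) ∧
        volume (closure (range γ) ∩ ball x₀ ρ ∩ {x | curl (u t) x ≠ 0}) ≠ 0) :
    ¬ FlatGaugeAtSingularity := by
  intro hFG
  obtain ⟨ν, T, u, p, x₀, hν, hT, hcl, hLH, hdec, hsing, hfvl⟩ := H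
  exact not_hasFlatSwirlGauge_of_fat_vortexLines hfvl
    ((hasFlatSwirlGauge_iff ν u T x₀).2 (hFG ν T hν hT u p hcl hLH hdec x₀ hsing))

end Summit.NavierStokesRegularity.NavierStokesRegularity.Theorems.FlatGaugeAtSingularity.Negative

end
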